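import Literature.Probability.RandomPlanarGeometry.SAWBridges
import Literature.Probability.RandomPlanarGeometry.SAWReflect
import Literature.Probability.RandomPlanarGeometry.SAWBridgeRadius

/-!
# Strip bridges at `x_c`: the mirrored reversal (Madras–Slade Lemma 4.1.12, first half)

Support file for crux item `stmt-CriticalPhenomena-4728` (`SAWRenewalTightness.ShellCrossingBound`),
line `kesten-defect-renewal`, stub `stub_tubeMass_of_stripDecay` (S3).

Vocabulary as in `SAWRenewalTightnessShellCrossingBoundTubeMassConcat.lean`: a *strip bridge of
width `W`, span `L`, from height `y` to height `y'`, with `n` steps* is an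
`ω ∈ SAW.Zd.bridges 2 n` with `ω n 0 = L`, `y + ω n 1 = y'`, `0 ≤ y + ω i 1 < W` (`i ≤ n`),
always written as the explicit `Finset.filter` of the line skeleton.

The map of this file is the second factor of the injection behind Madras–Slade, Lemma 4.1.12
(`G_{z,T}(x, y)² ≤ z⁻¹ G_{z,T}(x, x + (2L+1) e₁)`-type Schwarz bound for bridges): a strip bridge
`ω` of span `L` from height `y` to height `y'` is sent to
`υ = (0, e₁, e₁ + R(ω(n-1)) - R(ω(n)), …)`, precisely
`υ 0 = 0`, `υ j = R(ω (n + 1 - j)) - ω n` (`j ≥ 1`) with `R = SAW.Zd.reflAt 0 (2L+1)` the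
mirror `x₀ ↦ 2L + 1 - x₀`: one step east followed by the mirror image of `ω` run backwards. It is
a strip bridge of the same width, span `L + 1`, from height `y'` back to height `y`, with `n + 1`
steps, and `ω ↦ υ` is injective; hence (`criticalFugacity_mul_stripBridgeMass_le`)
`x_c · P(N; W, y, y', L) ≤ P(N + 1; W, y', y, L + 1)` for the partial sums of the critical mass.

## Contents (namespace `Summit.CriticalPhenomena.SAWScalingLimit.Theorems.TubeMass`, all proved)

* `rev_apply_zero_of_pos`, `rev_apply_one_of_pos` — coordinates of `υ`;
* `rev_mem_filter_of`, `rev_mem_filter` — `υ` is a strip bridge `y' → y` of span `L + 1` with `n + 1` steps;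
* `rev_inj` — `ω ↦ υ` is injective on strip bridges with given data;
* `criticalFugacity_mul_stripBridgeMass_le` (namespace `….Theorems`) — the weighted count.

References: N. Madras, G. Slade, *The Self-Avoiding Walk* (1993), Lemma 4.1.12 and (4.1.16).
-/

open Finset Literature.Probability.LatticeModels Literature.Probability.RandomPlanarGeometry
open Literature.Probability.RandomPlanarGeometry.SAW.Zd
open scoped BigOperators Classical

namespace Summit.CriticalPhenomena.SAWScalingLimit.Theorems

namespace TubeMass

/-! ### Coordinates of the mirrored reversal -/

/-- First coordinate of the mirrored reversal after time `0`: `L + 1 - ω(n+1-j)₀`. [folklore] -/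
theorem rev_apply_zero_of_pos {L : ℤ} {n : ℕ} {ω υ : ℕ → Site 2} (hL : ω n 0 = L)
    (hυs : ∀ j, 1 ≤ j → υ j = reflAt 0 (2 * L + 1) (ω (n + 1 - j)) - ω n) {j : ℕ} (hj : 1 ≤ j) :
    υ j 0 = L + 1 - ω (n + 1 - j) 0 := by
  rw [hυs j hj, Pi.sub_apply, reflAt_apply_same, hL]
  ring

/-- Second coordinate (height) of the mirrored reversal after time `0`: `ω(n+1-j)₁ - ω(n)₁`.
[folklore] -/
theorem rev_apply_one_of_pos {L : ℤ} {n : ℕ} {ω υ : ℕ → Site 2}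
    (hυs : ∀ j, 1 ≤ j → υ j = reflAt 0 (2 * L + 1) (ω (n + 1 - j)) - ω n) {j : ℕ} (hj : 1 ≤ j) :
    υ j 1 = ω (n + 1 - j) 1 - ω n 1 := by
  have h10 : (1 : Fin 2) ≠ 0 := by decide
  rw [hυs j hj, Pi.sub_apply, reflAt_apply_of_ne h10]

/-! ### The mirrored reversal of a strip bridge is a strip bridge -/

/-- **Mirrored reversal of a strip bridge** (the second factor of Madras–Slade's injection in
Lemma 4.1.12): if `ω` is a strip bridge of width `W` and span `L` from height `y` to height `y'`
with `n` steps, then `υ` (`υ 0 = 0`, `υ j = R(ω(n+1-j)) - ω(n)` for `j ≥ 1`, `R` the mirror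
`x₀ ↦ 2L+1-x₀`) is a strip bridge of width `W` and span `L + 1` from height `y'` to height `y`
with `n + 1` steps: its first step is `e₁`, then it runs through the mirror image of `ω`
backwards, whose first coordinates lie in `[1, L + 1]` with the maximum `L + 1` at the end.
[cite: MadrasSlade1993, Lemma 4.1.12] -/
theorem rev_mem_filter_of {W : ℕ} {y y' : ℤ} {L n : ℕ} {ω υ : ℕ → Site 2}
    (h : ω ∈ (SAW.Zd.bridges 2 n).filter (fun ω =>
      ω n 0 = (L : ℤ) ∧ y + ω n 1 = y' ∧ ∀ i ≤ n, 0 ≤ y + ω i 1 ∧ y + ω i 1 < W))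
    (hυ0 : υ 0 = 0) (hυs : ∀ j, 1 ≤ j → υ j = reflAt 0 (2 * (L : ℤ) + 1) (ω (n + 1 - j)) - ω n) :
    υ ∈ (SAW.Zd.bridges 2 (n + 1)).filter (fun ω =>
      ω (n + 1) 0 = ((L + 1 : ℕ) : ℤ) ∧ y' + ω (n + 1) 1 = y ∧
        ∀ i ≤ n + 1, 0 ≤ y' + ω i 1 ∧ y' + ω i 1 < W) := by
  rw [Finset.mem_filter] at h ⊢
  obtain ⟨hb, hL, hy, hs⟩ := h
  obtain ⟨hsaw, -⟩ := mem_bridges.1 hb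
  obtain ⟨h0, -, hadj, hinj⟩ := mem_saws.1 hsaw
  have h00 : (0 : Site 2) 0 = 0 := rfl
  have hx : ∀ j, 1 ≤ j → υ j 0 = (L : ℤ) + 1 - ω (n + 1 - j) 0 := fun j hj =>
    rev_apply_zero_of_pos hL hυs hj
  have hh : ∀ j, 1 ≤ j → υ j 1 = ω (n + 1 - j) 1 - ω n 1 := fun j hj =>
    rev_apply_one_of_pos hυs hj
  have hxnn : ∀ i ≤ n, 0 ≤ ω i 0 ∧ ω i 0 ≤ L := fun i hi => by
    rcases Nat.eq_zero_or_pos i with rfl | hpos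
    · rw [h0, h00]
      exact ⟨le_rfl, Nat.cast_nonneg L⟩
    · have := (mem_bridges.1 hb).2 i hpos hi
      rw [h0, h00, hL] at this
      exact ⟨this.1.le, this.2⟩
  refine ⟨mem_bridges.2 ⟨mem_saws.2 ⟨hυ0, ?_, ?_, ?_⟩, ?_⟩, ?_, ?_, ?_⟩
  · -- frozen after time `n + 1`
    intro i hi
    rw [hυs i (by omega), hυs (n + 1) (by omega), Nat.sub_self, (by omega : n + 1 - i = 0)]
  · -- nearest-neighbour steps
    intro i hi
    rcases Nat.eq_zero_or_pos i with rfl | hipos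
    · rw [hυ0, hυs (0 + 1) le_rfl, (by omega : n + 1 - (0 + 1) = n), ← hL,
        reflAt_two_mul_add_one, add_sub_cancel_left, zdGraph_adj_iff]
      exact ⟨0, Or.inl (by rw [zero_add])⟩
    · rw [hυs i hipos, hυs (i + 1) (by omega), zdGraph_adj_sub_right, zdGraph_adj_reflAt,
        show n + 1 - i = (n + 1 - (i + 1)) + 1 by omega]
      exact (hadj (n + 1 - (i + 1)) (by omega)).symm
  · -- injective on `[0, n + 1]`
    intro i hi j hj hij
    simp only [Set.mem_setOf_eq] at hi hj
    rcases Nat.eq_zero_or_pos i with rfl | hipos <;> rcases Nat.eq_zero_or_pos j with rfl | hjpos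
    · rfl
    · exfalso
      have e := congrFun hij 0
      rw [hυ0, h00, hx j hjpos] at e
      have := (hxnn (n + 1 - j) (by omega)).2
      linarith
    · exfalso
      have e := congrFun hij 0
      rw [hυ0, h00, hx i hipos] at e
      have := (hxnn (n + 1 - i) (by omega)).2
      linarith
    · rw [hυs i hipos, hυs j hjpos, sub_left_inj] at hij
      have e := reflAt_injective 0 _ hij
      have := hinj (show n + 1 - i ∈ {i | i ≤ n} by simp only [Set.mem_setOf_eq]; omega)
        (show n + 1 - j ∈ {i | i ≤ n} by simp only [Set.mem_setOf_eq]; omega) e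
      omega
  · -- a bridge: first coordinates in `(0, L + 1]`, the maximum at the end
    intro i h1 _h2
    rw [hυ0, h00, hx i h1, hx (n + 1) (by omega), Nat.sub_self, h0, h00]
    have := hxnn (n + 1 - i) (by omega)
    constructor <;> linarith [this.1, this.2]
  · -- span `L + 1`
    rw [hx (n + 1) (by omega), Nat.sub_self, h0, h00, Nat.cast_add, Nat.cast_one, sub_zero]
  · -- back to height `y`
    rw [hh (n + 1) (by omega), Nat.sub_self, h0, Pi.zero_apply, zero_sub]
    linarith
  · -- heights stay in `[0, W)`
    intro i _hi
    rcases Nat.eq_zero_or_pos i with rfl | hipos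
    · rw [hυ0, Pi.zero_apply, add_zero, ← hy]
      exact hs n le_rfl
    · rw [hh i hipos]
      have := hs (n + 1 - i) (by omega)
      constructor <;> linarith [this.1, this.2]

/-- The mirrored reversal, written as the explicit vertex function
`j ↦ if j = 0 then 0 else R(ω(n+1-j)) - ω(n)`, of a strip bridge of width `W` and span `L` from
height `y` to height `y'` with `n` steps is a strip bridge of width `W` and span `L + 1` from
height `y'` to height `y` with `n + 1` steps. [cite: MadrasSlade1993, Lemma 4.1.12] -/
theorem rev_mem_filter {W : ℕ} {y y' : ℤ} {L n : ℕ} {ω : ℕ → Site 2}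
    (h : ω ∈ (SAW.Zd.bridges 2 n).filter (fun ω =>
      ω n 0 = (L : ℤ) ∧ y + ω n 1 = y' ∧ ∀ i ≤ n, 0 ≤ y + ω i 1 ∧ y + ω i 1 < W)) :
    (fun j => if j = 0 then (0 : Site 2) else reflAt 0 (2 * (L : ℤ) + 1) (ω (n + 1 - j)) - ω n) ∈
      (SAW.Zd.bridges 2 (n + 1)).filter (fun ω =>
        ω (n + 1) 0 = ((L + 1 : ℕ) : ℤ) ∧ y' + ω (n + 1) 1 = y ∧
          ∀ i ≤ n + 1, 0 ≤ y' + ω i 1 ∧ y' + ω i 1 < W) :=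
  rev_mem_filter_of h (if_pos rfl) fun j hj => if_neg (by omega)

/-- **The mirrored reversal is injective** on the strip bridges of given width, span, heights
and length: the endpoint `ω(n) = (L, y' - y)` is prescribed, and `ω` is read off backwards from
`υ` by undoing the translation and the mirror. [cite: MadrasSlade1993, Lemma 4.1.12] -/
theorem rev_inj {W : ℕ} {y y' : ℤ} {L n : ℕ} {ω ω' : ℕ → Site 2}
    (h : ω ∈ (SAW.Zd.bridges 2 n).filter (fun ω =>
      ω n 0 = (L : ℤ) ∧ y + ω n 1 = y' ∧ ∀ i ≤ n, 0 ≤ y + ω i 1 ∧ y + ω i 1 < W))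
    (h' : ω' ∈ (SAW.Zd.bridges 2 n).filter (fun ω =>
      ω n 0 = (L : ℤ) ∧ y + ω n 1 = y' ∧ ∀ i ≤ n, 0 ≤ y + ω i 1 ∧ y + ω i 1 < W))
    (heq : (fun j => if j = 0 then (0 : Site 2) else
        reflAt 0 (2 * (L : ℤ) + 1) (ω (n + 1 - j)) - ω n) =
      (fun j => if j = 0 then (0 : Site 2) else
        reflAt 0 (2 * (L : ℤ) + 1) (ω' (n + 1 - j)) - ω' n)) : ω = ω' := by
  rw [Finset.mem_filter] at h h'
  obtain ⟨hb, hL, hy, -⟩ := h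
  obtain ⟨hb', hL', hy', -⟩ := h'
  have hend := (mem_saws.1 (mem_bridges.1 hb).1).2.1
  have hend' := (mem_saws.1 (mem_bridges.1 hb').1).2.1
  -- the endpoints agree
  have hn : ω n = ω' n := by
    funext k
    fin_cases k
    · show ω n 0 = ω' n 0
      rw [hL, hL']
    · show ω n 1 = ω' n 1
      linarith
  funext m
  rcases le_or_gt m n with hm | hm
  · have e := congrFun heq (n + 1 - m)
    simp only [if_neg (by omega : n + 1 - m ≠ 0), show n + 1 - (n + 1 - m) = m by omega, hn,
      sub_left_inj] at e
    exact reflAt_injective 0 _ e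
  · rw [hend m hm.le, hend' m hm.le, hn]

end TubeMass

/-! ### The weighted count: `x_c · P(N; W, y, y', L) ≤ P(N + 1; W, y', y, L + 1)` -/

open TubeMass in
/-- **Mirrored reversal, weighted form** (first half of Madras–Slade Lemma 4.1.12 for strip
bridges at `z = x_c`): for `L + 1 = K` and `N + 1 ≤ N'`,
`x_c · P(N; W, y, y', L) ≤ P(N'; W, y', y, K)`, where `P(N; W, y, y', L) = Σ_{n ≤ N} Σ_ω x_c^n`
sums over the `n`-step strip bridges of width `W` and span `L` from height `y` to height `y'`:
`ω ↦ υ` (`rev_mem_filter`, `rev_inj`) sends the `n`-step ones injectively to `(n+1)`-step strip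
bridges of span `L + 1` from `y'` to `y`, and `x_c · x_c^n = x_c^{n+1}`.
[cite: MadrasSlade1993, Lemma 4.1.12] -/
theorem criticalFugacity_mul_stripBridgeMass_le :
    ∀ (W : ℕ) (y y' : ℤ) (L K : ℕ), L + 1 = K → ∀ (N N' : ℕ), N + 1 ≤ N' →
      SAW.criticalFugacity *
        (∑ n ∈ Finset.range (N + 1),
          ∑ _ω ∈ (SAW.Zd.bridges 2 n).filter (fun ω =>
              ω n 0 = (L : ℤ) ∧ y + ω n 1 = y' ∧ ∀ i ≤ n, 0 ≤ y + ω i 1 ∧ y + ω i 1 < W),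
            SAW.criticalFugacity ^ n) ≤
      ∑ n ∈ Finset.range (N' + 1),
        ∑ _ω ∈ (SAW.Zd.bridges 2 n).filter (fun ω =>
            ω n 0 = (K : ℤ) ∧ y' + ω n 1 = y ∧ ∀ i ≤ n, 0 ≤ y' + ω i 1 ∧ y' + ω i 1 < W),
          SAW.criticalFugacity ^ n := by
  intro W y y' L K hK N N' hN
  subst hK
  have hxc : 0 ≤ SAW.criticalFugacity := SAW.criticalFugacity_pos.le
  rw [Finset.sum_sigma', Finset.sum_sigma', Finset.mul_sum]
  set S := (Finset.range (N + 1)).sigma fun n => (SAW.Zd.bridges 2 n).filter (fun ω =>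
    ω n 0 = (L : ℤ) ∧ y + ω n 1 = y' ∧ ∀ i ≤ n, 0 ≤ y + ω i 1 ∧ y + ω i 1 < W) with hS
  set T := (Finset.range (N' + 1)).sigma fun n => (SAW.Zd.bridges 2 n).filter (fun ω =>
    ω n 0 = ((L + 1 : ℕ) : ℤ) ∧ y' + ω n 1 = y ∧ ∀ i ≤ n, 0 ≤ y' + ω i 1 ∧ y' + ω i 1 < W)
    with hT
  set Ψ : (Σ _ : ℕ, (ℕ → Site 2)) → (Σ _ : ℕ, (ℕ → Site 2)) := fun p =>
    ⟨p.1 + 1, fun j => if j = 0 then (0 : Site 2) else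
      reflAt 0 (2 * (L : ℤ) + 1) (p.2 (p.1 + 1 - j)) - p.2 p.1⟩ with hΨ
  have hinj : Set.InjOn Ψ ↑S := by
    rintro ⟨n, ω⟩ hp ⟨n', ω'⟩ hp' h
    rw [Finset.mem_coe, hS, Finset.mem_sigma] at hp hp'
    simp only [hΨ, Sigma.mk.inj_iff, Nat.add_right_cancel_iff] at h
    obtain ⟨rfl, hυ⟩ := h
    rw [heq_eq_eq] at hυ
    obtain rfl := rev_inj hp.2 hp'.2 hυ
    rfl
  have hsub : S.image Ψ ⊆ T := by
    intro t ht
    rw [Finset.mem_image] at ht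
    obtain ⟨⟨n, ω⟩, hp, rfl⟩ := ht
    simp only [hS, Finset.mem_sigma, Finset.mem_range] at hp
    rw [hT, Finset.mem_sigma, Finset.mem_range]
    refine ⟨?_, rev_mem_filter hp.2⟩
    show n + 1 < N' + 1
    omega
  calc ∑ p ∈ S, SAW.criticalFugacity * SAW.criticalFugacity ^ p.1
      = ∑ p ∈ S, (fun t : Σ _ : ℕ, (ℕ → Site 2) => SAW.criticalFugacity ^ t.1) (Ψ p) :=
        Finset.sum_congr rfl fun p _ => by simp only [hΨ, pow_succ']
    _ = ∑ t ∈ S.image Ψ, SAW.criticalFugacity ^ t.1 :=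
        (Finset.sum_image (f := fun t : Σ _ : ℕ, (ℕ → Site 2) => SAW.criticalFugacity ^ t.1)
          hinj).symm
    _ ≤ ∑ t ∈ T, SAW.criticalFugacity ^ t.1 :=
        Finset.sum_le_sum_of_subset_of_nonneg hsub fun _ _ _ => pow_nonneg hxc _

end Summit.CriticalPhenomena.SAWScalingLimit.Theorems
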